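import Literature.NumberTheory.ComplexMultiplication.OcticCMFieldsWithDegenerateTypes
import HarnessLib

/-!
# The imaginary quadratic block of an octic CM field with `3 ∣ [Kᶜ : ℚ]` is unique, so a simple CM abelian
# fourfold is degenerate iff its type has weight `2` over THE block (Dodson 1984, §3.3.2 / §3.1.1)

B. Dodson, *The structure of Galois groups of CM-fields*, Trans. AMS **283** (1984) [Dodson1984] (held text
`paper:doi-10-2307-1999987`), §3.3.2 Theorem (p. 16): "Let `A` be a simple Abelian variety of CM-type `(K, Φ)`, with
`dim A = 4`.  Then `A` is degenerate if and only if `Gal(Kᶜ/ℚ) = ℤ₂ × A₄`, or `ℤ₂ × S₄` and `(K, Φ)` is the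
reflex of a type on a CM-field of degree `6`", read through §3.1.1 (p. 12: for `K ⊇ D` imaginary quadratic
"`Gal(Kᶜ/ℚ) = ⟨ρ⟩ × G₀`" with `G₀ = Gal(Kᶜ/D) ≅ Gal(K₀ᶜ/ℚ)`, so `G₀ ≅ A₄` or `S₄` in the theorem).  In these two
groups the imaginary quadratic subfield `D` is forced: `G₀ ∈ {A₄, S₄}` has no subgroup of index `2` compatible with
a second block.  This file records that uniqueness and the resulting sharp form of the classification of the sequel
`OcticCMFieldsWithDegenerateTypes` (which had "weight `2` over SOME block"):

* group level (`G` finite, faithful and transitive on `E`, a `4`-element block `E₀`, `3 ∣ |G|`):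
  **`IsCMTypeWith.eq_or_eq_rho_smul_of_block_four`** — any block `E₁` (a CM type mapped by everyone onto itself or
  its conjugate) is `E₀` or `ρE₀`.  Proof (classification-free): `G₁ = Stab(E₁)` has index `2`, so `m² ∈ G₀ ∩ G₁`
  for every `m ∈ G₀`; by the `2`-transitivity of `G₀` on the block (sequel, via `A₄ ≤` image) squares of elements
  of `G₀` move any point of `E₀` to any other, while `G₀ ∩ G₁` stabilises the trace `E₁ ∩ E₀` — which is therefore
  `∅` or `E₀`.
* number fields (`K` CM of degree `8`, `L = Kᶜ` a Galois CM normal closure, `3 ∣ [Kᶜ : ℚ]`):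
  **`cmType_block_unique`** — two CM types of `K` with quadratic reflex fields are equal or complementary
  (conjugate); hence **`not_isNondegenerate_iff_ncard_inter_eq_two`** — for a PRIMITIVE `Φ` and ANY block `Φ₀`:
  `Φ` degenerate ⟺ `|Φ ∩ Φ₀| = 2`; and, for an arbitrary octic CM field with a block,
  **`not_isNondegenerate_iff_ncard_inter_eq_two_and_dvd`**: `Φ` primitive is degenerate ⟺
  (`|Φ ∩ Φ₀| = 2` ∧ `3 ∣ [Kᶜ : ℚ]`).

KERNEL ONLY: theorems, no definition, no named fact (D-0014/D-0026).  Count-neutral for COR-CM; `HC_CM` is neither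
used nor mentioned.

## References

* [Dodson1984] B. Dodson, Trans. AMS 283 (1984) 1–32: §3.1.1 (pp. 11–12), §3.3.2 Theorem (pp. 16–17).
* [Shimura1998] G. Shimura, *Abelian varieties with complex multiplication and modular functions*, §8.2 Prop. 26.
-/

set_option autoImplicit false

open scoped Pointwise

namespace Literature.NumberTheory.ComplexMultiplication

/-! ## Part I — group level: the block is unique -/

section GroupLevel

variable {G : Type*} [Group G] {E : Type*} [MulAction G E] {ρ : G} {E₀ E₁ : Set E}

namespace IsCMTypeWith

/-- A block with `4` elements has a point other than two given ones. [folklore] -/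
private theorem exists_mem_ne_ne' [Finite E] (h4 : E₀.ncard = 4) (u v : E) : ∃ z ∈ E₀, z ≠ u ∧ z ≠ v := by
  by_contra hno
  push Not at hno
  have hsub : E₀ ⊆ {u, v} := fun z hz => by
    by_cases hzu : z = u
    · exact Or.inl hzu
    · exact Or.inr (hno z hz hzu)
  have h1 := Set.ncard_le_ncard hsub (Set.toFinite _)
  have h2 : ({u, v} : Set E).ncard ≤ 2 := (Set.ncard_insert_le u {v}).trans (by rw [Set.ncard_singleton])
  omega

/-- Squares of elements of `G₀` lie in every subgroup of index `2`. [folklore] -/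
private theorem mul_self_mem_of_index_eq_two {G₀ G₁ : Subgroup G} (h2 : G₁.index = 2) {m : G} (hm : m ∈ G₀) :
    m * m ∈ G₀ ⊓ G₁ := by
  haveI : G₁.Normal := Subgroup.normal_of_index_eq_two h2
  refine ⟨G₀.mul_mem hm hm, ?_⟩
  have hdvd : G₁.relIndex G₀ ∣ 2 := h2 ▸ Subgroup.relIndex_dvd_index_of_normal (H := G₁) (K := G₀)
  rcases (Nat.dvd_prime Nat.prime_two).1 hdvd with h1 | h1
  · exact G₁.mul_mem (Subgroup.relIndex_eq_one.1 h1 hm) (Subgroup.relIndex_eq_one.1 h1 hm)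
  · have := Subgroup.mul_self_mem_of_index_two (H := G₁.subgroupOf G₀) h1 ⟨m, hm⟩
    exact this

variable [FaithfulSMul G E] [Finite E] [Finite G] [MulAction.IsPretransitive G E]

/-- **The block is unique** ("`Gal(Kᶜ/ℚ) = ⟨ρ⟩ × G₀`" with `G₀ ≅ A₄` or `S₄`): for a finite group acting
faithfully and transitively on `E` with a `4`-element block `E₀` and `3 ∣ |G|`, every block `E₁` is `E₀` or `ρE₀`.
[cite: Dodson1984, §3.3.2 Theorem; §3.1.1 Theorem] -/
theorem eq_or_eq_rho_smul_of_block_four (h₀ : IsCMTypeWith ρ E₀)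
    (hG₀ : ∀ g : G, g • E₀ = E₀ ∨ g • E₀ = ρ • E₀) (h4 : E₀.ncard = 4) (h3 : 3 ∣ Nat.card G)
    (h₁ : IsCMTypeWith ρ E₁) (hG₁ : ∀ g : G, g • E₁ = E₁ ∨ g • E₁ = ρ • E₁) : E₁ = E₀ ∨ E₁ = ρ • E₀ := by
  classical
  have hne : E₀.Nonempty := Set.nonempty_of_ncard_ne_zero (by rw [h4]; norm_num)
  haveI : Nonempty E := ⟨hne.some⟩
  -- the trace `T = E₁ ∩ E₀` is `∅` or `E₀`
  have htrace : E₁ ∩ E₀ = ∅ ∨ E₀ ⊆ E₁ := by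
    by_contra hno
    push Not at hno
    obtain ⟨hne', hns⟩ := hno
    obtain ⟨x, hx⟩ := hne'
    obtain ⟨y, hy, hyE₁⟩ := Set.not_subset.1 hns
    obtain ⟨z, hz, hzx, hzy⟩ := exists_mem_ne_ne' (E₀ := E₀) h4 x y
    -- `m ∈ G₀` with `m x = z`, `m z = y` (2-transitivity of `G₀` on the block)
    obtain ⟨m, hm, hmx, hmz⟩ := h₀.exists_mem_stabilizer_smul_eq_of_block_four hG₀ h4 h3 hx.2 hz hz hy
      (Ne.symm hzx) hzy
    -- `m² ∈ G₀ ∩ G₁` stabilises the trace, but moves `x ∈ T` to `y ∉ T`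
    have hmm := mul_self_mem_of_index_eq_two (G₀ := MulAction.stabilizer G E₀)
      (h₁.index_stabilizer_eq_two_of_block hG₁) hm
    have h0' : (m * m) • E₀ = E₀ := hmm.1
    have h1' : (m * m) • E₁ = E₁ := hmm.2
    have hy' : y ∈ (m * m) • (E₁ ∩ E₀) := by
      rw [mul_smul, ← hmz, ← hmx]
      exact Set.smul_mem_smul_set (Set.smul_mem_smul_set hx)
    rw [Set.smul_set_inter, h0', h1'] at hy'
    exact hyE₁ hy'.1
  rcases htrace with h | h
  · right
    refine h₁.eq_of_inter_eq (h₀.smul_set ρ) h₀ ?_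
    rw [h, h₀.rho_smul_set_eq_compl, Set.compl_inter_self]
  · left
    refine h₁.eq_of_inter_eq h₀ h₀ ?_
    rw [Set.inter_self, Set.inter_eq_right.2 h]

end IsCMTypeWith

end GroupLevel

/-! ## Part II — octic CM fields: THE block, and degenerate ⟺ weight `2` -/

section Octic

open NumberField
open Literature.AlgebraicGeometry.Motives (CMType)
open Literature.AlgebraicGeometry.Pohlmann1968

variable {K : Type} [Field K] [NumberField K]
variable {L : Type} [Field L] [NumberField L] [IsCMField L] [IsGalois ℚ L]

omit [IsCMField L] [IsGalois ℚ L] in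
/-- `algValuedIn` is injective (it is a preimage under a bijection). [folklore] -/
private theorem algValuedIn_injective [Normal ℚ L] (j : K →ₐ[ℚ] L) (ι : L →+* ℂ) {Ψ Ψ' : Set (K →+* ℂ)}
    (h : algValuedIn ι Ψ = algValuedIn ι Ψ') : Ψ = Ψ' := by
  ext τ
  obtain ⟨χ, rfl⟩ := (algHomEquivRingHomOfNormal j ι).surjective τ
  exact Set.ext_iff.1 h χ

omit [IsCMField L] [IsGalois ℚ L] in
/-- `algValuedIn` commutes with complements. [folklore] -/
private theorem algValuedIn_compl (ι : L →+* ℂ) (Ψ : Set (K →+* ℂ)) : algValuedIn ι Ψᶜ = (algValuedIn ι Ψ)ᶜ := rfl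

/-- **THE block: an octic CM field with `3 ∣ [Kᶜ : ℚ]` has at most one CM type with quadratic reflex field, up to
conjugation** — two such types `Φ₀, Φ₁` satisfy `Φ₁ = Φ₀` or `Φ₁ = Φ̄₀ = Φ₀ᶜ` ("`Gal(Kᶜ/ℚ) = ⟨ρ⟩ × G₀`", `G₀`
being `A₄` or `S₄`; `L = Kᶜ` a normal closure). [cite: Dodson1984, §3.3.2 Theorem; §3.1.1 Theorem] -/
theorem cmType_block_unique [IsNormalClosure ℚ K L] (hK : Module.finrank ℚ K = 8) (j : K →ₐ[ℚ] L)
    (ι : L →+* ℂ) (h3 : 3 ∣ Module.finrank ℚ L) (Φ₀ Φ₁ : CMType K)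
    (h₀2 : Module.finrank ℚ (reflexField ℚ L (algValuedIn ι Φ₀.1)) = 2)
    (h₁2 : Module.finrank ℚ (reflexField ℚ L (algValuedIn ι Φ₁.1)) = 2) :
    Φ₁ = Φ₀ ∨ Φ₁.1 = Φ₀.1ᶜ := by
  have h₀ := isCMTypeWith_conjGal_algValuedIn ι Φ₀
  have h₁ := isCMTypeWith_conjGal_algValuedIn ι Φ₁
  have hG₀ := smul_algValuedIn_eq_or_of_finrank_reflexField_eq_two j ι Φ₀ h₀2
  have hG₁ := smul_algValuedIn_eq_or_of_finrank_reflexField_eq_two j ι Φ₁ h₁2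
  have h4 : (algValuedIn ι Φ₀.1).ncard = 4 := by rw [ncard_algValuedIn j ι, ncard_cmType_eq, hK]
  have h3' : 3 ∣ Nat.card (L ≃ₐ[ℚ] L) := by rwa [IsGalois.card_aut_eq_finrank]
  rcases h₀.eq_or_eq_rho_smul_of_block_four hG₀ h4 h3' h₁ hG₁ with h | h
  · exact Or.inl (Subtype.ext (algValuedIn_injective j ι h))
  · right
    rw [h₀.rho_smul_set_eq_compl, ← algValuedIn_compl] at h
    exact algValuedIn_injective j ι h

/-- **Dodson §3.3.2 at a fixed block: for an octic CM field with `3 ∣ [Kᶜ : ℚ]`, a PRIMITIVE CM type `Φ` is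
degenerate iff it has weight `2` over THE block `Φ₀`** (any CM type with quadratic reflex field).
[cite: Dodson1984, §3.3.2 Theorem] [cite: MoonenZarhin1995Duke, Thm. 2.4] -/
theorem not_isNondegenerate_iff_ncard_inter_eq_two [IsCMField K] [IsNormalClosure ℚ K L]
    (hK : Module.finrank ℚ K = 8) (j : K →ₐ[ℚ] L) (ι : L →+* ℂ) (h3 : 3 ∣ Module.finrank ℚ L)
    (Φ₀ : CMType K) (h₀2 : Module.finrank ℚ (reflexField ℚ L (algValuedIn ι Φ₀.1)) = 2)
    (Φ : CMType K) (φ₀ : K →+* ℂ) (hprim : IsPrimitive (ℂ ≃+* ℂ) Φ.1 φ₀) :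
    ¬ IsNondegenerate Φ ↔ (Φ.1 ∩ Φ₀.1).ncard = 2 := by
  refine ⟨fun hdeg => ?_, fun h2 => not_isNondegenerate_of_ncard_inter_eq_two hK j ι Φ₀ Φ h₀2 h2⟩
  obtain ⟨Φ₁, h₁2, h2⟩ := (not_isNondegenerate_iff_exists_block_ncard_inter_eq_two hK j ι Φ φ₀ hprim).1 hdeg
  rcases cmType_block_unique hK j ι h3 Φ₀ Φ₁ h₀2 h₁2 with h | h
  · rwa [h] at h2
  · -- `|Φ ∩ Φ₀ᶜ| = 2` and `|Φ| = 4` give `|Φ ∩ Φ₀| = 2`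
    rw [h] at h2
    have hsum := Set.ncard_inter_add_ncard_sdiff_eq_ncard Φ.1 Φ₀.1 (Set.toFinite _)
    rw [Set.sdiff_eq, ncard_cmType_eq, hK, h2] at hsum
    omega

/-- **The same for an arbitrary octic CM field with a block**: a PRIMITIVE `Φ` is degenerate iff it has weight `2`
over the block AND `3 ∣ [Kᶜ : ℚ]` (without the divisibility — `G₀ ∈ {C₄, V₄, D₄}` — there are no degenerate simple
CM fourfolds at all; sequel `three_dvd_card_gal_of_not_isNondegenerate`). [cite: Dodson1984, §3.3.2 Theorem] -/
theorem not_isNondegenerate_iff_ncard_inter_eq_two_and_dvd [IsCMField K] [IsNormalClosure ℚ K L]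
    (hK : Module.finrank ℚ K = 8) (j : K →ₐ[ℚ] L) (ι : L →+* ℂ)
    (Φ₀ : CMType K) (h₀2 : Module.finrank ℚ (reflexField ℚ L (algValuedIn ι Φ₀.1)) = 2)
    (Φ : CMType K) (φ₀ : K →+* ℂ) (hprim : IsPrimitive (ℂ ≃+* ℂ) Φ.1 φ₀) :
    ¬ IsNondegenerate Φ ↔ (Φ.1 ∩ Φ₀.1).ncard = 2 ∧ 3 ∣ Module.finrank ℚ L := by
  constructor
  · intro hdeg
    have h3 : 3 ∣ Module.finrank ℚ L := by
      rw [← IsGalois.card_aut_eq_finrank]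
      exact three_dvd_card_gal_of_not_isNondegenerate hK j ι Φ φ₀ hprim hdeg
    exact ⟨(not_isNondegenerate_iff_ncard_inter_eq_two hK j ι h3 Φ₀ h₀2 Φ φ₀ hprim).1 hdeg, h3⟩
  · rintro ⟨h2, -⟩
    exact not_isNondegenerate_of_ncard_inter_eq_two hK j ι Φ₀ Φ h₀2 h2

end Octic

end Literature.NumberTheory.ComplexMultiplication
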